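import Summits.AtomisticToContinuum.HydrodynamicLimit.Theorems.CollisionIsometryCLTDiffuseBackwardInfluenceDefs
import Summits.AtomisticToContinuum.HydrodynamicLimit.Theorems.CollisionIsometryCLTDiffuseBackwardInfluenceRowBudgetN
import Summits.AtomisticToContinuum.HydrodynamicLimit.Theorems.CollisionIsometryCLTDiffuseBackwardInfluenceOnePathBound
import Summits.AtomisticToContinuum.HydrodynamicLimit.Theorems.CollisionIsometryCLTDiffuseBackwardInfluenceEntropyTransfer
import Summits.AtomisticToContinuum.HydrodynamicLimit.Theorems.CollisionIsometryCLTDiffuseBackwardInfluenceFewIdleSuperExp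
import Summits.AtomisticToContinuum.HydrodynamicLimit.Theorems.CollisionIsometryCLTDiffuseBackwardInfluenceLateMergesRare
import Summits.AtomisticToContinuum.HydrodynamicLimit.Theorems.CollisionIsometryCLTDiffuseBackwardInfluenceLateTouchRare
import Summits.AtomisticToContinuum.HydrodynamicLimit.Theorems.CollisionIsometryCLTDiffuseBackwardInfluenceOneFlightShareLD
import Summits.AtomisticToContinuum.HydrodynamicLimit.Theorems.CollisionIsometryCLTDiffuseBackwardInfluenceTubeLD
import Summits.AtomisticToContinuum.HydrodynamicLimit.Theorems.CollisionIsometryCLTDiffuseBackwardInfluenceStubStickLD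
import Summits.AtomisticToContinuum.HydrodynamicLimit.Theorems.DiffuseBackwardInfluence.Negative.FreeDirection
import Literature.MathematicalPhysics.KineticTheory.HardSphereEulerProofs

/-!
# The crux `DiffuseBackwardInfluence` CONDITIONALLY on its two open dynamical inputs (line `share-nondegeneracy-one-flight`)
(stmt-AtomisticToContinuum-12950, route `CollisionIsometryCLT`; lead prover, continuation c2; `--supports` file)

This file moves the line's kernel-checked COMPOSITION from the never-imported skeleton
(`Cruxes/DiffuseBackwardInfluence/Lines/share_nondegeneracy_one_flight.lean`) into the tree, as a CONDITIONAL theorem: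

  `diffuseBackwardInfluence_of_nearSetLD_of_lateTouchRare :
      (∃ σ₀ > 0, ∀ σ ∈ (0, σ₀), ∀ θ > 0, ShareLD.NearSetLD σ θ) → LateMerges.LateTouchRare →
      Theses.CollisionIsometryCLT.DiffuseBackwardInfluence`

i.e. crux ⇐ (prescribed-set directional LD = the lever, `@[conjecture] ShareLD.NearSetLD`) ∧ (late host–host contacts of the
two tracers are rare, `LateMerges.LateTouchRare`). The tube/idleness input is no longer a hypothesis: `stub_stickLD` is a THEOREM
(lead c2, wave 1: the 7/3 crossing-energy law `stub_stickSupersat` + containers `stickLD_of_supersat` p124395), imported. The two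
remaining hypotheses are the crux-sized inputs analysed in `Cruxes/DiffuseBackwardInfluence/NOTES.md` §2, §7, §11 (N-uniform
one-collision chaos; N-uniform pair transience of tracer hosts). Everything else — row budget (p87871), pathwise one-path bound
(p95322), probability-form entropy transfer (p87454), the reductions `fewIdleSuperExp_of_tubeLD` (p87551), `tubeLD_of_stickLD`
(p121785), `shareLDAt_of_nearSetLD` (p121117/p119310), `lateMergesRareAll_of_lateTouchRare` (p87761) — is imported, and the
composition below (`union_rate_le`, `ipr_le_of_onePathBound`, `cruxConclusion_of_statements`) is the skeleton's, verbatim.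
Nothing here is asserted without proof; the theorem is conditional exactly on its two displayed hypotheses.
-/

namespace Summit.AtomisticToContinuum.HydrodynamicLimit.Theorems.DiffuseBackwardInfluenceShare

open scoped BigOperators Topology ENNReal InnerProductSpace Classical
open Filter Set MeasureTheory
open Literature.Analysis.FluidPDE (Config HardSphereFlow collidePair)
open Literature.MathematicalPhysics.KineticTheory (localGibbsLaw hsDiameter isProbabilityMeasure_localGibbsLaw)
open Summit.AtomisticToContinuum.HydrodynamicLimit.Theorems.DiffuseBackwardInfluenceNeg

noncomputable section

/-! ## Proved composition -/

/-- Arithmetic of the union bound: `2S·e^{−(C+3)n} ≤ e^{−(C+2)n}` as soon as `2S ≤ n`. -/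
theorem union_rate_le {S : ℕ} {C n : ℝ} (hn : (2 * S : ℝ) ≤ n) :
    2 * (S : ℝ) * Real.exp (-((C + 3) * n)) ≤ Real.exp (-((C + 2) * n)) := by
  have hkey : Real.exp (-((C + 3) * n)) = Real.exp (-((C + 2) * n)) * Real.exp (-n) := by
    rw [← Real.exp_add]; congr 1; ring
  rw [hkey]
  have h1 : 2 * (S : ℝ) * Real.exp (-n) ≤ 1 := by
    have he : n + 1 ≤ Real.exp n := Real.add_one_le_exp n
    have hpos : 0 < Real.exp n := Real.exp_pos n
    rw [Real.exp_neg, ← div_eq_mul_inv, div_le_one hpos]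
    linarith
  have hpos := Real.exp_pos (-((C + 2) * n))
  calc 2 * (S : ℝ) * (Real.exp (-((C + 2) * n)) * Real.exp (-n))
      = Real.exp (-((C + 2) * n)) * (2 * (S : ℝ) * Real.exp (-n)) := by ring
    _ ≤ Real.exp (-((C + 2) * n)) * 1 := by gcongr
    _ = Real.exp (-((C + 2) * n)) := mul_one _

/-- The PATHWISE dichotomy fed to the integral: with `B` the union of the bad per-slot events at level `δ`, the
one-path bound gives `ipr ≤ 9(2(1−η)^m + 8δ + LM)` off `B` and `ipr ≤ 9(2(1−η)^m + 8 + LM)` on `B`. -/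
theorem ipr_le_of_onePathBound {σ : ℝ} (h₁ : OnePathBound σ) {N : ℕ} (y : Cfg N) {Δ η δ : ℝ} (hΔ : 0 < Δ)
    (hη : 0 < η) (hη1 : η < 1) (hδ : 0 ≤ δ) {m L : ℕ} (hm : 1 ≤ m) (hL : 1 ≤ L)
    (B : Set (Cfg N))
    (hB : ∀ y ∉ B, ∀ r : ℕ, r < 2 * m * L →
      idleFr σ N y Δ (2 * m * L) r < δ ∧ degFr σ N y Δ (2 * m * L) r η < δ) :
    ipr σ N y Δ ≤ 9 * (2 * (1 - η) ^ m + 8 * δ) + 9 * lateMergeFr σ N y Δ L + 72 * B.indicator (fun _ => (1 : ℝ)) y := by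
  by_cases hy : y ∈ B
  · have h := h₁ N y Δ hΔ η hη hη1 m L hm hL 2 (fun r _ => by
      have h1 := idleFr_le_one σ N y Δ (2 * m * L) r
      have h2 := degFr_le_one σ N y Δ (2 * m * L) r η
      linarith)
    rw [Set.indicator_of_mem hy]
    nlinarith [h, hδ]
  · have h := h₁ N y Δ hΔ η hη hη1 m L hm hL (2 * δ) (fun r hr => by
      have h1 := (hB y hy r hr).1
      have h2 := (hB y hy r hr).2
      linarith)
    rw [Set.indicator_of_notMem hy]
    linarith

/-- COMPOSITION (kernel-checked, no sorry): the six stub STATEMENTS imply the crux's conclusion for `σ` below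
`σ₀ := min (1/2, σ₃, σ₄(profiles), σₑ(profiles))`. Bookkeeping for a target `e > 0`: late merges `≤ e/36` fix `L`;
`δ := e/288`; transfer rate `h := C+2`, stub rates `C+3`; `η₀ ← ShareLD`, `η := min(η₀/2, 1/2)`; `m` with
`(1−η)^m ≤ e/72`; grid `S := 2mL`; bad event `B_N := ⋃_{r<S}({δ ≤ idleFr_r} ∪ {δ ≤ degFr_r})`, `G_N(B_N) ≤ 2S e^{−(C+3)(N+1)}
≤ e^{−(C+2)(N+1)}` eventually (union bound, no measurability), transferred: `P_N(Φ ∈ B_N) ≤ e/288` eventually; the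
pathwise dichotomy is integrated against the probability measure `localGibbsLaw` through the measurable hull of
`Φ⁻¹B_N`: `E[ipr] ≤ 9(2·e/72 + 8·e/288) + 9·e/36 + 72·e/288 = e`. -/
theorem cruxConclusion_of_statements
    (h₀ : ∀ σ : ℝ, RowBudgetN σ)
    (h₁ : ∀ σ : ℝ, RowBudgetN σ → OnePathBound σ)
    (h₂ : ∀ σ θ : ℝ, 0 < σ → σ < 1 / 2 → 0 < θ → ∀ Φ : (N : ℕ) → Flow σ N, FewIdleSuperExpAt σ θ Φ)
    (h₃ : ∃ σ₀ : ℝ, 0 < σ₀ ∧ ∀ σ : ℝ, 0 < σ → σ < σ₀ → ∀ θ : ℝ, 0 < θ → ∀ δ h : ℝ, 0 < δ → 0 < h →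
      ∃ η₀ : ℝ, 0 < η₀ ∧ ∀ η : ℝ, 0 < η → η < η₀ → ∀ Φ : (N : ℕ) → Flow σ N, ShareLDAt σ θ δ h η Φ)
    (h₄ : ∀ (a₀ θ₀ : T3 → ℝ) (u₀ : T3 → V3), Continuous a₀ → Continuous θ₀ → Continuous u₀ →
      (∀ x, 0 < a₀ x) → (∀ x, 0 < θ₀ x) → ∃ σ₀ : ℝ, 0 < σ₀ ∧ ∀ σ : ℝ, 0 < σ → σ < σ₀ →
      ∀ Φ : (N : ℕ) → Flow σ N, LateMergesRareAt σ a₀ θ₀ u₀ Φ)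
    (h₅ : ∀ (a₀ θ₀ : T3 → ℝ) (u₀ : T3 → V3), Continuous a₀ → Continuous θ₀ → Continuous u₀ →
      (∀ x, 0 < a₀ x) → (∀ x, 0 < θ₀ x) → ∃ σₑ : ℝ, 0 < σₑ ∧ ∀ σ : ℝ, 0 < σ → σ < σₑ →
      ∃ θ : ℝ, 0 < θ ∧ ∃ C : ℝ, 0 ≤ C ∧ EntropyTransferAt σ θ C a₀ θ₀ u₀)
    (a₀ θ₀ : T3 → ℝ) (u₀ : T3 → V3) (ha : Continuous a₀) (hθ : Continuous θ₀) (hu : Continuous u₀)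
    (ha0 : ∀ x, 0 < a₀ x) (hθ0 : ∀ x, 0 < θ₀ x) :
    ∃ σ₀ : ℝ, 0 < σ₀ ∧ ∀ σ : ℝ, 0 < σ → σ < σ₀ →
      ∀ Φ : (N : ℕ) → Flow σ N, CruxConclusionAt σ a₀ θ₀ u₀ Φ := by
  obtain ⟨σ₃, hσ₃, H3⟩ := h₃
  obtain ⟨σ₄, hσ₄, H4⟩ := h₄ a₀ θ₀ u₀ ha hθ hu ha0 hθ0
  obtain ⟨σₑ, hσₑ, H5⟩ := h₅ a₀ θ₀ u₀ ha hθ hu ha0 hθ0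
  refine ⟨min (1 / 2) (min σ₃ (min σ₄ σₑ)), lt_min (by norm_num) (lt_min hσ₃ (lt_min hσ₄ hσₑ)), ?_⟩
  intro σ hσ hσlt Φ Δ hΔp hΔ0 hΔg t ht
  have hσ2 : σ < 1 / 2 := lt_of_lt_of_le hσlt (min_le_left _ _)
  have hσ3 : σ < σ₃ := lt_of_lt_of_le hσlt ((min_le_right _ _).trans (min_le_left _ _))
  have hσ4 : σ < σ₄ :=
    lt_of_lt_of_le hσlt ((min_le_right _ _).trans ((min_le_right _ _).trans (min_le_left _ _)))
  have hσe : σ < σₑ :=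
    lt_of_lt_of_le hσlt ((min_le_right _ _).trans ((min_le_right _ _).trans (min_le_right _ _)))
  obtain ⟨θ, hθpos, C, hC0, HT⟩ := H5 σ hσ hσe
  have H1 : OnePathBound σ := h₁ σ (h₀ σ)
  have H2 : FewIdleSuperExpAt σ θ Φ := h₂ σ θ hσ hσ2 hθpos Φ
  have H4' : LateMergesRareAt σ a₀ θ₀ u₀ Φ := H4 σ hσ hσ4 Φ
  -- the local Gibbs laws are probability measures (σ ≤ 1/2)
  have hP : ∀ N, IsProbabilityMeasure (localGibbsLaw σ a₀ u₀ θ₀ N (Φ N)) := fun N =>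
    isProbabilityMeasure_localGibbsLaw ha hθ hu ha0 hθ0 hσ2.le N (Φ N)
  rw [ENNReal.tendsto_nhds_zero]
  intro ε hε
  by_cases hεtop : ε = ⊤
  · exact Eventually.of_forall fun N => hεtop ▸ le_top
  -- work with the real target `e`
  set e : ℝ := ε.toReal with he_def
  have he : 0 < e := ENNReal.toReal_pos hε.ne' hεtop
  have hεe : ENNReal.ofReal e = ε := ENNReal.ofReal_toReal hεtop
  -- late merges: fix `L`
  obtain ⟨L, hL1, hL⟩ := H4' Δ hΔp hΔ0 hΔg t ht (e / 36) (by positivity)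
  -- level `δ`, transfer rate `h`, stub rate `h'`
  set δ : ℝ := e / 288 with hδ_def
  have hδ : 0 < δ := by positivity
  set h : ℝ := C + 2 with hh_def
  have hCh : C < h := by rw [hh_def]; linarith
  set h' : ℝ := C + 3 with hh'_def
  have hh' : 0 < h' := by rw [hh'_def]; linarith
  -- the lever: fix `η`
  obtain ⟨η₀, hη₀, H3'⟩ := H3 σ hσ hσ3 θ hθpos δ h' hδ hh'
  set η : ℝ := min (η₀ / 2) (1 / 2) with hη_def
  have hη0 : 0 < η := lt_min (by positivity) (by norm_num)
  have hηlt : η < η₀ := lt_of_le_of_lt (min_le_left _ _) (by linarith)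
  have hη1 : η < 1 := lt_of_le_of_lt (min_le_right _ _) (by norm_num)
  have H3'' : ShareLDAt σ θ δ h' η Φ := H3' η hη0 hηlt Φ
  -- depth `m`
  obtain ⟨m, hm1, hm⟩ : ∃ m : ℕ, 1 ≤ m ∧ (1 - η) ^ m ≤ e / 72 := by
    obtain ⟨n, hn⟩ := exists_pow_lt_of_lt_one (by positivity : 0 < e / 72) (by linarith : 1 - η < 1)
    refine ⟨n + 1, Nat.le_add_left 1 n, ?_⟩
    calc (1 - η) ^ (n + 1) ≤ (1 - η) ^ n :=
          pow_le_pow_of_le_one (by linarith) (by linarith) (Nat.le_succ n)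
      _ ≤ e / 72 := hn.le
  -- the grid
  set S : ℕ := 2 * m * L with hS_def
  have hS : 1 ≤ S := by
    rw [hS_def]
    calc 1 ≤ m * L := Nat.one_le_iff_ne_zero.2 (Nat.mul_ne_zero (by omega) (by omega))
      _ ≤ 2 * m * L := by nlinarith
  -- the bad event: some slot has idle fraction or degeneracy score ≥ δ
  set I : (N : ℕ) → ℕ → Set (Cfg N) := fun N r => {y | δ ≤ idleFr σ N y (Δ N) S r} with hI_def
  set D : (N : ℕ) → ℕ → Set (Cfg N) := fun N r => {y | δ ≤ degFr σ N y (Δ N) S r η} with hD_def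
  set B : (N : ℕ) → Set (Cfg N) := fun N => ⋃ r ∈ Finset.range S, (I N r ∪ D N r) with hB_def
  have hBc : ∀ N, ∀ y ∉ B N, ∀ r : ℕ, r < 2 * m * L →
      idleFr σ N y (Δ N) (2 * m * L) r < δ ∧ degFr σ N y (Δ N) (2 * m * L) r η < δ := by
    intro N y hy r hr
    have hr' : r ∈ Finset.range S := Finset.mem_range.2 (hS_def ▸ hr)
    have hy' : y ∉ I N r ∪ D N r := fun hmem => hy (Set.mem_biUnion hr' hmem)
    simp only [hI_def, hD_def, Set.mem_union, Set.mem_setOf_eq, not_or, not_le] at hy'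
    exact hy'
  -- G_N(B_N) ≤ e^{-h(N+1)} eventually: union bound over the 2S per-slot events at rate h'
  have hslots : ∀ᶠ N : ℕ in atTop, ∀ r ∈ Finset.range S,
      eqLaw σ θ N (Φ N) (I N r) ≤ ENNReal.ofReal (Real.exp (-(h' * ((N : ℝ) + 1)))) ∧
      eqLaw σ θ N (Φ N) (D N r) ≤ ENNReal.ofReal (Real.exp (-(h' * ((N : ℝ) + 1)))) := by
    refine (Filter.eventually_all_finset _).2 fun r hr => ?_
    have hr' : r < S := Finset.mem_range.1 hr
    exact (H2 Δ hΔp hΔ0 hΔg S r hS hr' δ h' hδ hh').and (H3'' Δ hΔp hΔ0 hΔg S r hS hr')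
  have hGB : ∀ᶠ N : ℕ in atTop,
      eqLaw σ θ N (Φ N) (B N) ≤ ENNReal.ofReal (Real.exp (-(h * ((N : ℝ) + 1)))) := by
    filter_upwards [hslots, Filter.eventually_ge_atTop (2 * S)] with N hN hN2
    have hsum : eqLaw σ θ N (Φ N) (B N) ≤
        ∑ r ∈ Finset.range S, (ENNReal.ofReal (Real.exp (-(h' * ((N : ℝ) + 1)))) +
          ENNReal.ofReal (Real.exp (-(h' * ((N : ℝ) + 1))))) := by
      calc eqLaw σ θ N (Φ N) (B N)
          ≤ ∑ r ∈ Finset.range S, eqLaw σ θ N (Φ N) (I N r ∪ D N r) := measure_biUnion_finset_le _ _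
        _ ≤ ∑ r ∈ Finset.range S, (eqLaw σ θ N (Φ N) (I N r) + eqLaw σ θ N (Φ N) (D N r)) :=
            Finset.sum_le_sum fun r _ => measure_union_le _ _
        _ ≤ _ := Finset.sum_le_sum fun r hr => add_le_add (hN r hr).1 (hN r hr).2
    refine hsum.trans ?_
    have hx0 : (0 : ℝ) ≤ Real.exp (-(h' * ((N : ℝ) + 1))) := (Real.exp_pos _).le
    rw [← ENNReal.ofReal_add hx0 hx0, Finset.sum_const, Finset.card_range, nsmul_eq_mul,
      ← ENNReal.ofReal_natCast, ← ENNReal.ofReal_mul (Nat.cast_nonneg S)]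
    refine ENNReal.ofReal_le_ofReal ?_
    have hn : (2 * S : ℝ) ≤ (N : ℝ) + 1 := by exact_mod_cast (by omega : 2 * S ≤ N + 1)
    have key := union_rate_le (S := S) (C := C) hn
    rw [hh_def, hh'_def]
    nlinarith [key]
  -- transfer to the evolved law
  have hPB : ∀ᶠ N : ℕ in atTop, localGibbsLaw σ a₀ u₀ θ₀ N (Φ N)
      ((Φ N).flow (t - Δ N) ⁻¹' B N) ≤ ENNReal.ofReal (e / 288) :=
    HT Φ B h hCh hGB (fun N => t - Δ N) (e / 288) (by positivity)
  -- integrate the pathwise dichotomy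
  filter_upwards [hPB, hL] with N hN hLN
  set μ : Measure (Cfg N) := localGibbsLaw σ a₀ u₀ θ₀ N (Φ N) with hμ
  haveI : IsProbabilityMeasure μ := hP N
  set T := (Φ N).flow (t - Δ N) with hT
  set B' : Set (Cfg N) := toMeasurable μ (T ⁻¹' B N) with hB'
  have hB'm : MeasurableSet B' := measurableSet_toMeasurable _ _
  have hB'μ : μ B' = μ (T ⁻¹' B N) := measure_toMeasurable _
  have hsub : T ⁻¹' B N ⊆ B' := subset_toMeasurable _ _
  set A : ℝ := 9 * (2 * (1 - η) ^ m + 8 * δ) with hA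
  have hA0 : 0 ≤ A := by positivity
  -- pointwise bound of the integrand by constant + one term + measurable indicator
  have hpt : ∀ z, ENNReal.ofReal (ipr σ N (T z) (Δ N)) ≤
      (ENNReal.ofReal A + ENNReal.ofReal (9 * lateMergeFr σ N (T z) (Δ N) L)) +
        B'.indicator (fun _ => (72 : ℝ≥0∞)) z := by
    intro z
    have h1 := ipr_le_of_onePathBound H1 (T z) (hΔp N) hη0 hη1 hδ.le hm1 hL1 (B N) (hBc N)
    have hind : (72 : ℝ) * (B N).indicator (fun _ => (1 : ℝ)) (T z) ≤
        ((B'.indicator (fun _ => (72 : ℝ≥0∞)) z).toReal) := by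
      by_cases hz : T z ∈ B N
      · have hz' : z ∈ B' := hsub hz
        simp [Set.indicator_of_mem hz, Set.indicator_of_mem hz']
      · simp [Set.indicator_of_notMem hz]
    have hind_ne_top : B'.indicator (fun _ => (72 : ℝ≥0∞)) z ≠ ⊤ := by
      by_cases hz' : z ∈ B'
      · simp [Set.indicator_of_mem hz']
      · simp [Set.indicator_of_notMem hz']
    calc ENNReal.ofReal (ipr σ N (T z) (Δ N))
        ≤ ENNReal.ofReal (A + 9 * lateMergeFr σ N (T z) (Δ N) L +
            (B'.indicator (fun _ => (72 : ℝ≥0∞)) z).toReal) :=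
          ENNReal.ofReal_le_ofReal (by rw [hA]; linarith)
      _ ≤ ENNReal.ofReal (A + 9 * lateMergeFr σ N (T z) (Δ N) L) +
            ENNReal.ofReal ((B'.indicator (fun _ => (72 : ℝ≥0∞)) z).toReal) := ENNReal.ofReal_add_le
      _ ≤ (ENNReal.ofReal A + ENNReal.ofReal (9 * lateMergeFr σ N (T z) (Δ N) L)) +
            B'.indicator (fun _ => (72 : ℝ≥0∞)) z :=
          add_le_add ENNReal.ofReal_add_le (ENNReal.ofReal_toReal hind_ne_top).le
  have hmeas_ind : Measurable (B'.indicator (fun _ => (72 : ℝ≥0∞))) :=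
    measurable_const.indicator hB'm
  calc ∫⁻ z, ENNReal.ofReal (ipr σ N (T z) (Δ N)) ∂μ
      ≤ ∫⁻ z, ((ENNReal.ofReal A + ENNReal.ofReal (9 * lateMergeFr σ N (T z) (Δ N) L)) +
          B'.indicator (fun _ => (72 : ℝ≥0∞)) z) ∂μ := lintegral_mono hpt
    _ = ∫⁻ z, (ENNReal.ofReal A + ENNReal.ofReal (9 * lateMergeFr σ N (T z) (Δ N) L)) ∂μ +
          ∫⁻ z, B'.indicator (fun _ => (72 : ℝ≥0∞)) z ∂μ := lintegral_add_right _ hmeas_ind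
    _ = (∫⁻ _z, ENNReal.ofReal A ∂μ + ∫⁻ z, ENNReal.ofReal (9 * lateMergeFr σ N (T z) (Δ N) L) ∂μ) +
          ∫⁻ z, B'.indicator (fun _ => (72 : ℝ≥0∞)) z ∂μ := by
        rw [lintegral_add_left measurable_const]
    _ = (ENNReal.ofReal A + 9 * ∫⁻ z, ENNReal.ofReal (lateMergeFr σ N (T z) (Δ N) L) ∂μ) +
          72 * μ B' := by
        rw [lintegral_const, measure_univ, mul_one, lintegral_indicator_const hB'm]
        congr 2
        rw [← lintegral_const_mul' _ _ (by norm_num : (9 : ℝ≥0∞) ≠ ⊤)]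
        refine lintegral_congr fun z => ?_
        rw [ENNReal.ofReal_mul (by norm_num : (0 : ℝ) ≤ 9)]
        norm_num
    _ ≤ (ENNReal.ofReal A + 9 * ENNReal.ofReal (e / 36)) + 72 * ENNReal.ofReal (e / 288) := by
        rw [hB'μ]
        gcongr
    _ = ENNReal.ofReal (A + 9 * (e / 36) + 72 * (e / 288)) := by
        rw [ENNReal.ofReal_add (by positivity) (by positivity), ENNReal.ofReal_add hA0 (by positivity),
          ENNReal.ofReal_mul (by norm_num : (0 : ℝ) ≤ 9), ENNReal.ofReal_mul (by norm_num : (0 : ℝ) ≤ 72)]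
        norm_num
    _ ≤ ENNReal.ofReal e := by
        refine ENNReal.ofReal_le_ofReal ?_
        rw [hA, hδ_def]
        nlinarith [hm]
    _ = ε := hεe

/-- **THE CRUX, CONDITIONALLY** (registered sub-goal `diffuseBackwardInfluence_of_nearSetLD_of_lateTouchRare`): the
prescribed-set directional large deviation (the lever) and rarity of late host–host contacts of the two tracers together imply
`DiffuseBackwardInfluence` — the line's composition with the tube input discharged (`stub_stickLD`, landed) and its two open
registered stubs turned into hypotheses (the crux's `let M`, `let ipr` are `DiffuseBackwardInfluenceNeg.transfer/ipr`
definitionally). [folklore] -/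
theorem diffuseBackwardInfluence_of_nearSetLD_of_lateTouchRare : (∃ σ₀ : ℝ, 0 < σ₀ ∧ ∀ σ : ℝ, 0 < σ → σ < σ₀ → ∀ θ : ℝ, 0 < θ → ShareLD.NearSetLD σ θ) → LateMerges.LateTouchRare → Summit.AtomisticToContinuum.HydrodynamicLimit.Theses.CollisionIsometryCLT.DiffuseBackwardInfluence := by
  intro hNear hLate a₀ θ₀ u₀ ha hθ hu ha0 hθ0
  have h₂ : ∀ σ θ : ℝ, 0 < σ → σ < 1 / 2 → 0 < θ → ∀ Φ : (N : ℕ) → Flow σ N, FewIdleSuperExpAt σ θ Φ :=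
    fun σ θ h1 h2 h3 => fewIdleSuperExp_of_tubeLD σ θ h1 h2 h3 (tubeLD_of_stickLD σ θ h1 h2 h3 (stub_stickLD σ θ h1 h2 h3))
  have h₃ : ∃ σ₀ : ℝ, 0 < σ₀ ∧ ∀ σ : ℝ, 0 < σ → σ < σ₀ → ∀ θ : ℝ, 0 < θ → ∀ δ h : ℝ, 0 < δ → 0 < h →
      ∃ η₀ : ℝ, 0 < η₀ ∧ ∀ η : ℝ, 0 < η → η < η₀ → ∀ Φ : (N : ℕ) → Flow σ N, ShareLDAt σ θ δ h η Φ := by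
    obtain ⟨σ₀, hσ₀, H⟩ := hNear
    exact ⟨σ₀, hσ₀, fun σ hσ hσlt θ hθ' => shareLDAt_of_nearSetLD σ θ (H σ hσ hσlt θ hθ')⟩
  obtain ⟨σ₀, hσ₀, H⟩ := cruxConclusion_of_statements stub_rowBudgetN stub_onePathBound h₂ h₃
    (lateMergesRareAll_of_lateTouchRare hLate) stub_entropyTransfer a₀ θ₀ u₀ ha hθ hu ha0 hθ0
  refine ⟨σ₀, hσ₀, ?_⟩
  intro σ hσ hσlt M ipr' Φ Δ hΔ hΔ0 hΔ1 t ht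
  exact H σ hσ hσlt Φ Δ hΔ hΔ0 hΔ1 t ht

end

end Summit.AtomisticToContinuum.HydrodynamicLimit.Theorems.DiffuseBackwardInfluenceShare
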